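import Summits.QuantumFields.YangMills.Theorems.UnitScaleTiltProp7TrueLinRealityFamilies
import Summits.QuantumFields.YangMills.Theorems.UnitScaleTiltProp7CovIterLambdaBound
import Literature.MathematicalPhysics.QuantumFieldTheory.Balaban1983to89.B7Eq31BCH
import Literature.MathematicalPhysics.QuantumFieldTheory.Balaban1983to89.B10StarCount
import HarnessLib

/-!
# Route `UnitScaleTilt`, crux K1 «MinimiserStabilityRegPr» (stmt-QuantumFields-19200), route-R (n3) growth side, TWISTED reading — LEMMA (Ξ):
# THE TOP LOG-RATIO AT A GAUGE-TWISTED BACKGROUND IS, TO FIRST ORDER, THE COARSE PURE GAUGE OF `log h`: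
# `‖log((V^h)_c·V_c*) − (μ(c₋) − V_c·μ(c₊)·V_c*)‖ ≤ 2‖μ(c₋)‖·‖μ(c₊)‖`, `μ := log ∘ h`, and `Σ_c … ≤ 2d·Σ_y‖μ(y)‖²`

Cell `ym3-torus`, D-0154 (3c) twin-width seat `ym-routeR-w1` (gen 4).  THEOREMS ONLY (0 `def`, 0 `sorry`); `--supports stmt-QuantumFields-19200`, count-neutral.
YM₃ on T³ is a ladder rung (R3), not the Clay problem; nothing here claims a stub, the crux, d = 4 or the mass gap.

WHY (the namer's LOCATE, ★p1 g14 2026-08-28 15:39Z (4)).  The growth-side door with the JOINT row MODULO COARSE GAUGE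
(✓ `Prop7LocMinOfGaugedRows.isMinOn_regFibrePr_of_gaugedRows_at`) asks, for every competitor, for an `𝔰𝔲`-valued coarse site field `μ` with
`Σ_c‖Q^{(k)}(iD)(c) − (μ(c₋) − W̄(c)μ(c₊)W̄(c)*)‖` small.  On the UNTWISTED fibre the top log-ratio `X_k = log(W̄′^{(k)}_c·W̄^{(k)}_c*)` vanishes and
the supplier is the reduced sourced family alone (✓ `Prop7FibreLogRatioGaugedL1`).  On a Σ-TWISTED datum ([Balaban1985RegularSpaces] p.81: «Σ_k is not contained in
𝔅_k(𝔅_k, V)») the competitor's `k`-fold average is a GAUGE TWIST `V^h` of the background's average `V` (`h` a coarse gauge transformation near `1`,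
[Balaban1985Averaging] (11)–(13): `Ū^u = (Ū)^{u^{(k)}}`, tree ✓ `T4Continuum.iter_gaugeAct`), so the top term of the gauged row is `X_k(c) = log((V^h)_c·V_c*)` with
`(V^h)_c = h(c₋)·V_c·h(c₊)⁻¹` ([Balaban1985Averaging] (8)).  THIS FILE: that top term is a coarse pure gauge up to a term QUADRATIC in `log h` — by the
second-order BCH estimate [Balaban1985Averaging] (31) (`‖log(eˣe^Y) − X − Y‖ ≤ 2‖X‖‖Y‖`, tree ✓ `B7Eq31BCH.eq31_of_sum_le`) at `X = log h(c₋)`,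
`Y = −V_c·log h(c₊)·V_c*` (`V_c·e^{−log h(c₊)}·V_c* = e^{−V_c log h(c₊) V_c*}`, Mathlib `Matrix.exp_units_conj`).  Summing over the bonds of the torus
(each site is the initial point of `d` bonds and the final point of `d` bonds, ✓ `B10StarCount.sum_pbond` ∕ `shiftEquiv`) gives the namer's count
«top cost `= O(Σ_y‖ν(y)‖²)`» with the constant `2d`.  The remaining TWISTED input — ROW (T), an `(M, K)`-currency bound on `Σ_y‖log h(y)‖²` for the
twist `h = (u^{(k)})⁻¹` of the Landau representative — is NOT in this file.

WHAT IS PROVED (ns `…Theorems.Prop7GaugeTwistLogRatio`; `SU(N)` for any nonempty `Fintype n`, any `P`, any level `k`).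
* §1 matrix letters: `exp_conj_coe` (`e^{gXg*} = g·eˣ·g*`), `star_coe_eq_exp_neg_mlog` (`g* = e^{−log g}`) (unitary conjugation is an isometry: ✓ `Prop7CovIterLambdaBound.norm_conj_su_le`),
  ★★ `norm_mlog_twist_sub_pureGauge_le` (`‖log(g₋·V·g₊*·V*) − (log g₋ − V·log g₊·V*)‖ ≤ 2‖log g₋‖‖log g₊‖` for `‖g± − 1‖ ≤ σ ≤ 1∕20`) and its
  letter form `… ≤ 8σ²`.
* §2 bond letters: `coe_pertVar_gaugeAct_add_one` (`Y_c(V, V^h) + 1 = h(c₋)·V_c·h(c₊)*·V_c*`), ★★ `norm_mlog_pertVar_gaugeAct_sub_pureGauge_le` (LEMMA (Ξ) per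
  bond), `…_le_sq` (`≤ 8σ²`), and the `𝔰𝔲` rows `su_mlog_transf` ∕ `su_pureGauge_mlog_transf` (via ✓ `Prop7TrueLinRealityFamilies.su_mlog_of_mem`, ✓ `su_pureGauge`).
* §3 the count: `sum_pbond_src`, `sum_pbond_tgt` (`Σ_c f(c±) = d·Σ_y f(y)`), ★★ `sum_norm_mlog_pertVar_gaugeAct_sub_pureGauge_le`
  (`Σ_c‖…‖ ≤ 2d·Σ_y‖log h(y)‖²`).
* §4 the splice for the door's `∃ μ` row: ★ `gaugedRow_of_twistedRow` — from ANY row `Σ_c‖Q(c) + (Λ(c₋) − V_cΛ(c₊)V_c*) − log((V^h)_cV_c*)‖ ≤ R` (the shape of the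
  fibre reading with the top term displayed) to `Σ_c‖Q(c) − (μ(c₋) − V_cμ(c₊)V_c*)‖ ≤ R + 2d·Σ_y‖log h(y)‖²` with the EXPLICIT `μ := log ∘ h − Λ`, `𝔰𝔲`-valued when
  `Λ` is.
HONEST SCOPE.  Matrix analysis over two cited tree theorems ((31) and the bond count); nothing of the twist's SIZE (ROW (T)) or of the fibre geometry is asserted.

References: T. Bałaban, CMP 98 (1985) 17–51 [Balaban1985Averaging] ((8), (11)–(13) p.19, (21) p.21, (31) p.22); CMP 99 (1985) 75–102 [Balaban1985RegularSpaces]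
((1.31) p.81); CMP 102 (1985) 277–309 [Balaban1985Variational] ((15) p.280, (47)–(48) pp.285–286).
-/

set_option autoImplicit false

noncomputable section

open scoped BigOperators Matrix.Norms.L2Operator
open NormedSpace

namespace Summit.QuantumFields.YangMills.Theorems.Prop7GaugeTwistLogRatio

open Literature.MathematicalPhysics.QuantumFieldTheory.Balaban1983to89
open BlockAveragingEMLLinearisedBackground (pertVar)
open MatrixLog (mlog exp_mlog norm_mlog_le_two_mul)
open ExpMeanLog (deltaSU)
open B7Eq31BCH (eq31_of_sum_le)
open B10StarCount (sum_pbond shiftEquiv)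
open Summit.QuantumFields.YangMills.Theorems.Prop7HolRatioPerStep (coe_star_mul_self coe_mul_star_self norm_coe_eq_one norm_star_coe_eq_one)
open Summit.QuantumFields.YangMills.Theorems.Prop7TrueLinReality (su_sub su_pureGauge)
open Summit.QuantumFields.YangMills.Theorems.Prop7TrueLinRealityFamilies (su_mlog_of_mem)
open Summit.QuantumFields.YangMills.Theorems.Prop7CovIterLambdaBound (norm_conj_su_le)

variable {n : Type*} [Fintype n] [DecidableEq n] [Nonempty n]

/-! ## §1 Matrix letters: the twisted product `g₋·V·g₊*·V*` to first order -/

section MatrixLetters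

omit [Nonempty n] in
/-- `e^{g X g*} = g·eˣ·g*` for `g ∈ SU(N)` (Mathlib `Matrix.exp_units_conj` at the unit `(g, g*)`). [folklore] -/
theorem exp_conj_coe (g : Matrix.specialUnitaryGroup n ℂ) (X : Matrix n n ℂ) :
    exp ((g : Matrix n n ℂ) * X * star (g : Matrix n n ℂ)) = (g : Matrix n n ℂ) * exp X * star (g : Matrix n n ℂ) := by
  have h := Matrix.exp_units_conj
    (⟨(g : Matrix n n ℂ), star (g : Matrix n n ℂ), coe_mul_star_self g, coe_star_mul_self g⟩ : (Matrix n n ℂ)ˣ) X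
  simpa only [Units.val_mk, Units.inv_mk] using h

omit [Nonempty n] in
/-- `g* = e^{−log g}` for `g ∈ SU(N)` with `‖g − 1‖ < 1` (`e^{log g} = g`, ✓ `MatrixLog.exp_mlog`, and `e^{−A} = (e^{A})⁻¹`, Mathlib `Matrix.exp_neg`).
[cite: Balaban1985Averaging, (21) p.21] -/
theorem star_coe_eq_exp_neg_mlog (g : Matrix.specialUnitaryGroup n ℂ) (hg : ‖(g : Matrix n n ℂ) - 1‖ < 1) :
    star (g : Matrix n n ℂ) = exp (-mlog (g : Matrix n n ℂ)) := by
  rw [Matrix.exp_neg, exp_mlog hg]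
  exact (Matrix.inv_eq_left_inv (coe_star_mul_self g)).symm

/-- ★★ **THE TWISTED PRODUCT TO FIRST ORDER.**  For `g₋, g₊, V ∈ SU(N)` with `‖g± − 1‖ ≤ σ ≤ 1∕20` and `μ± := log g±`:
`‖log(g₋·V·g₊*·V*) − (μ₋ − V·μ₊·V*)‖ ≤ 2‖μ₋‖·‖μ₊‖` — (31) at `X = μ₋`, `Y = −Vμ₊V*` (`g₋·V·g₊*·V* = e^{μ₋}·e^{−Vμ₊V*}`, `‖μ±‖ ≤ 2σ ≤ 1∕10`).
[cite: Balaban1985Averaging, (31) p.22, (8) p.19] -/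
theorem norm_mlog_twist_sub_pureGauge_le (gm gp V : Matrix.specialUnitaryGroup n ℂ) {σ : ℝ} (hσ : σ ≤ 1 / 20)
    (hm : ‖(gm : Matrix n n ℂ) - 1‖ ≤ σ) (hp : ‖(gp : Matrix n n ℂ) - 1‖ ≤ σ) :
    ‖mlog ((gm : Matrix n n ℂ) * (V : Matrix n n ℂ) * star (gp : Matrix n n ℂ) * star (V : Matrix n n ℂ))
        - (mlog (gm : Matrix n n ℂ) - (V : Matrix n n ℂ) * mlog (gp : Matrix n n ℂ) * star (V : Matrix n n ℂ))‖
      ≤ 2 * ‖mlog (gm : Matrix n n ℂ)‖ * ‖mlog (gp : Matrix n n ℂ)‖ := by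
  have hm1 : ‖(gm : Matrix n n ℂ) - 1‖ < 1 := by linarith
  have hp1 : ‖(gp : Matrix n n ℂ) - 1‖ < 1 := by linarith
  have hμm : ‖mlog (gm : Matrix n n ℂ)‖ ≤ 2 * σ := (norm_mlog_le_two_mul (by linarith)).trans (by linarith)
  have hμp : ‖mlog (gp : Matrix n n ℂ)‖ ≤ 2 * σ := (norm_mlog_le_two_mul (by linarith)).trans (by linarith)
  set X : Matrix n n ℂ := mlog (gm : Matrix n n ℂ) with hX
  set Y : Matrix n n ℂ := -((V : Matrix n n ℂ) * mlog (gp : Matrix n n ℂ) * star (V : Matrix n n ℂ)) with hY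
  have hYle : ‖Y‖ ≤ ‖mlog (gp : Matrix n n ℂ)‖ := by rw [hY, norm_neg]; exact norm_conj_su_le V _
  -- the product is `eˣ·e^Y`
  have hprod : (gm : Matrix n n ℂ) * (V : Matrix n n ℂ) * star (gp : Matrix n n ℂ) * star (V : Matrix n n ℂ) = exp X * exp Y := by
    rw [hY, ← neg_mul, ← mul_neg, exp_conj_coe V, ← star_coe_eq_exp_neg_mlog gp hp1, hX, exp_mlog hm1]
    simp only [mul_assoc]
  have hsum : ‖X‖ + ‖Y‖ ≤ 1 / 5 := by linarith
  have h31 := eq31_of_sum_le hsum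
  have e : mlog ((gm : Matrix n n ℂ) * (V : Matrix n n ℂ) * star (gp : Matrix n n ℂ) * star (V : Matrix n n ℂ))
      - (mlog (gm : Matrix n n ℂ) - (V : Matrix n n ℂ) * mlog (gp : Matrix n n ℂ) * star (V : Matrix n n ℂ)) = mlog (exp X * exp Y) - X - Y := by
    rw [hprod, hX, hY]; abel
  rw [e]
  have h0 : 0 ≤ ‖X‖ := norm_nonneg X
  calc ‖mlog (exp X * exp Y) - X - Y‖ ≤ 2 * ‖X‖ * ‖Y‖ := h31
    _ ≤ 2 * ‖X‖ * ‖mlog (gp : Matrix n n ℂ)‖ := by gcongr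

/-- The letter form: `‖log(g₋·V·g₊*·V*) − (log g₋ − V·log g₊·V*)‖ ≤ 8σ²` for `‖g± − 1‖ ≤ σ ≤ 1∕20` (`‖log g±‖ ≤ 2σ`, ✓ `MatrixLog.norm_mlog_le_two_mul`).
[cite: Balaban1985Averaging, (31) p.22, (23) p.21] -/
theorem norm_mlog_twist_sub_pureGauge_le_sq (gm gp V : Matrix.specialUnitaryGroup n ℂ) {σ : ℝ} (hσ : σ ≤ 1 / 20)
    (hm : ‖(gm : Matrix n n ℂ) - 1‖ ≤ σ) (hp : ‖(gp : Matrix n n ℂ) - 1‖ ≤ σ) :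
    ‖mlog ((gm : Matrix n n ℂ) * (V : Matrix n n ℂ) * star (gp : Matrix n n ℂ) * star (V : Matrix n n ℂ))
        - (mlog (gm : Matrix n n ℂ) - (V : Matrix n n ℂ) * mlog (gp : Matrix n n ℂ) * star (V : Matrix n n ℂ))‖ ≤ 8 * σ ^ 2 := by
  have hσ0 : 0 ≤ σ := (norm_nonneg _).trans hm
  have hμm : ‖mlog (gm : Matrix n n ℂ)‖ ≤ 2 * σ := (norm_mlog_le_two_mul (by linarith)).trans (by linarith)
  have hμp : ‖mlog (gp : Matrix n n ℂ)‖ ≤ 2 * σ := (norm_mlog_le_two_mul (by linarith)).trans (by linarith)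
  refine (norm_mlog_twist_sub_pureGauge_le gm gp V hσ hm hp).trans ?_
  have h0 : 0 ≤ ‖mlog (gm : Matrix n n ℂ)‖ := norm_nonneg _
  calc 2 * ‖mlog (gm : Matrix n n ℂ)‖ * ‖mlog (gp : Matrix n n ℂ)‖ ≤ 2 * (2 * σ) * (2 * σ) := by gcongr
    _ = 8 * σ ^ 2 := by ring

end MatrixLetters

/-! ## §2 Bond letters: the log-ratio of a gauge twist `V^h` against `V` -/

section BondLetters

variable {P : Params} {k : ℕ}

/-- **THE RATIO OF A GAUGE TWIST**: `Y_c(V, V^h) + 1 = (V^h)_c·V_c⁻¹ = h(c₋)·V_c·h(c₊)*·V_c*` read in `M_N(ℂ)` (`(V^h)_c = h(c₋)V_c h(c₊)⁻¹`, the inverse in `SU(N)` is the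
conjugate transpose). [cite: Balaban1985Averaging, (8) p.19; Balaban1985Variational, (15) p.280] -/
theorem coe_pertVar_gaugeAct_add_one (V : GaugeField P k (Matrix.specialUnitaryGroup n ℂ)) (h : GaugeTransf P k (Matrix.specialUnitaryGroup n ℂ)) (c : PBond P k) :
    pertVar V (GaugeField.gaugeAct h V) c + 1
      = ((h c.src : Matrix.specialUnitaryGroup n ℂ) : Matrix n n ℂ) * ((V c : Matrix.specialUnitaryGroup n ℂ) : Matrix n n ℂ)
          * star ((h c.tgt : Matrix.specialUnitaryGroup n ℂ) : Matrix n n ℂ) * star ((V c : Matrix.specialUnitaryGroup n ℂ) : Matrix n n ℂ) := by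
  rw [pertVar, sub_add_cancel]
  rfl

/-- ★★ **LEMMA (Ξ), ONE BOND.**  For `SU(N)` fields `V` (background) and a gauge transformation `h` with `‖h(y) − 1‖ ≤ σ ≤ 1∕20` at the two ends of the bond `c`, with
`μ := log ∘ h`: `‖log(Y_c(V, V^h) + 1) − (μ(c₋) − V_c·μ(c₊)·V_c*)‖ ≤ 2‖μ(c₋)‖·‖μ(c₊)‖` — the top log-ratio of a gauge-twisted background is the coarse pure gauge
`P_V(μ)(c)` (the letter of ✓ `Prop7TrueLinPureGaugeIter.trueLinIter_pureGauge` ∕ ✓ `Prop7LocMinOfGaugedRows`) up to second order in `μ`.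
[cite: Balaban1985Averaging, (31) p.22, (8) p.19, (11) p.19] -/
theorem norm_mlog_pertVar_gaugeAct_sub_pureGauge_le (V : GaugeField P k (Matrix.specialUnitaryGroup n ℂ))
    (h : GaugeTransf P k (Matrix.specialUnitaryGroup n ℂ)) {σ : ℝ} (hσ : σ ≤ 1 / 20) (c : PBond P k)
    (hs : ‖((h c.src : Matrix.specialUnitaryGroup n ℂ) : Matrix n n ℂ) - 1‖ ≤ σ) (ht : ‖((h c.tgt : Matrix.specialUnitaryGroup n ℂ) : Matrix n n ℂ) - 1‖ ≤ σ) :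
    ‖mlog (pertVar V (GaugeField.gaugeAct h V) c + 1)
        - (mlog ((h c.src : Matrix.specialUnitaryGroup n ℂ) : Matrix n n ℂ)
            - ((V c : Matrix.specialUnitaryGroup n ℂ) : Matrix n n ℂ) * mlog ((h c.tgt : Matrix.specialUnitaryGroup n ℂ) : Matrix n n ℂ)
              * star ((V c : Matrix.specialUnitaryGroup n ℂ) : Matrix n n ℂ))‖
      ≤ 2 * ‖mlog ((h c.src : Matrix.specialUnitaryGroup n ℂ) : Matrix n n ℂ)‖ * ‖mlog ((h c.tgt : Matrix.specialUnitaryGroup n ℂ) : Matrix n n ℂ)‖ := by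
  rw [coe_pertVar_gaugeAct_add_one]
  exact norm_mlog_twist_sub_pureGauge_le (h c.src) (h c.tgt) (V c) hσ hs ht

/-- LEMMA (Ξ), one bond, letter form `≤ 8σ²`. [cite: Balaban1985Averaging, (31) p.22, (23) p.21] -/
theorem norm_mlog_pertVar_gaugeAct_sub_pureGauge_le_sq (V : GaugeField P k (Matrix.specialUnitaryGroup n ℂ))
    (h : GaugeTransf P k (Matrix.specialUnitaryGroup n ℂ)) {σ : ℝ} (hσ : σ ≤ 1 / 20) (c : PBond P k)
    (hs : ‖((h c.src : Matrix.specialUnitaryGroup n ℂ) : Matrix n n ℂ) - 1‖ ≤ σ) (ht : ‖((h c.tgt : Matrix.specialUnitaryGroup n ℂ) : Matrix n n ℂ) - 1‖ ≤ σ) :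
    ‖mlog (pertVar V (GaugeField.gaugeAct h V) c + 1)
        - (mlog ((h c.src : Matrix.specialUnitaryGroup n ℂ) : Matrix n n ℂ)
            - ((V c : Matrix.specialUnitaryGroup n ℂ) : Matrix n n ℂ) * mlog ((h c.tgt : Matrix.specialUnitaryGroup n ℂ) : Matrix n n ℂ)
              * star ((V c : Matrix.specialUnitaryGroup n ℂ) : Matrix n n ℂ))‖ ≤ 8 * σ ^ 2 := by
  rw [coe_pertVar_gaugeAct_add_one]
  exact norm_mlog_twist_sub_pureGauge_le_sq (h c.src) (h c.tgt) (V c) hσ hs ht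

/-- The gauge letter `μ = log ∘ h` is `𝔰𝔲(N)`-valued on the (0.4) guard `‖h(y) − 1‖ < δ_N` (✓ `Prop7TrueLinRealityFamilies.su_mlog_of_mem`).
[cite: Balaban1987RG1, (0.4) p.253; Balaban1985Averaging, (23) p.21] -/
theorem su_mlog_transf (h : GaugeTransf P k (Matrix.specialUnitaryGroup n ℂ)) (y : Site P k)
    (h1 : ‖((h y : Matrix.specialUnitaryGroup n ℂ) : Matrix n n ℂ) - 1‖ < deltaSU n) :
    star (mlog ((h y : Matrix.specialUnitaryGroup n ℂ) : Matrix n n ℂ)) = -mlog ((h y : Matrix.specialUnitaryGroup n ℂ) : Matrix n n ℂ)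
      ∧ (mlog ((h y : Matrix.specialUnitaryGroup n ℂ) : Matrix n n ℂ)).trace = 0 :=
  su_mlog_of_mem (h y).prop h1

/-- The coarse pure gauge `μ(c₋) − V_cμ(c₊)V_c*` of `μ = log ∘ h` is `𝔰𝔲(N)`-valued on the (0.4) guard (✓ `Prop7TrueLinReality.su_pureGauge`).
[cite: Balaban1985Averaging, (11) p.19, (23) p.21] -/
theorem su_pureGauge_mlog_transf (V : GaugeField P k (Matrix.specialUnitaryGroup n ℂ)) (h : GaugeTransf P k (Matrix.specialUnitaryGroup n ℂ)) (c : PBond P k)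
    (hs : ‖((h c.src : Matrix.specialUnitaryGroup n ℂ) : Matrix n n ℂ) - 1‖ < deltaSU n) (ht : ‖((h c.tgt : Matrix.specialUnitaryGroup n ℂ) : Matrix n n ℂ) - 1‖ < deltaSU n) :
    star (mlog ((h c.src : Matrix.specialUnitaryGroup n ℂ) : Matrix n n ℂ)
            - ((V c : Matrix.specialUnitaryGroup n ℂ) : Matrix n n ℂ) * mlog ((h c.tgt : Matrix.specialUnitaryGroup n ℂ) : Matrix n n ℂ)
              * star ((V c : Matrix.specialUnitaryGroup n ℂ) : Matrix n n ℂ))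
        = -(mlog ((h c.src : Matrix.specialUnitaryGroup n ℂ) : Matrix n n ℂ)
            - ((V c : Matrix.specialUnitaryGroup n ℂ) : Matrix n n ℂ) * mlog ((h c.tgt : Matrix.specialUnitaryGroup n ℂ) : Matrix n n ℂ)
              * star ((V c : Matrix.specialUnitaryGroup n ℂ) : Matrix n n ℂ))
      ∧ (mlog ((h c.src : Matrix.specialUnitaryGroup n ℂ) : Matrix n n ℂ)
            - ((V c : Matrix.specialUnitaryGroup n ℂ) : Matrix n n ℂ) * mlog ((h c.tgt : Matrix.specialUnitaryGroup n ℂ) : Matrix n n ℂ)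
              * star ((V c : Matrix.specialUnitaryGroup n ℂ) : Matrix n n ℂ)).trace = 0 :=
  su_pureGauge V (su_mlog_transf h c.src hs) (su_mlog_transf h c.tgt ht) c

end BondLetters

/-! ## §3 The count over the bonds of the torus: `Σ_c(…) ≤ 2d·Σ_y‖log h(y)‖²` -/

section Count

variable {P : Params} {k : ℕ}

omit [Fintype n] [DecidableEq n] [Nonempty n] in
/-- `Σ_c f(c₋) = d·Σ_y f(y)`: each site is the initial point of exactly `d` positively oriented bonds (✓ `B10StarCount.sum_pbond`). [cite: Balaban1985Averaging, (5) p.18] -/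
theorem sum_pbond_src (f : Site P k → ℝ) : ∑ c : PBond P k, f c.src = P.d * ∑ y : Site P k, f y := by
  rw [sum_pbond (fun c : PBond P k => f c.src)]
  simp only [Finset.sum_const, Finset.card_univ, Fintype.card_fin, nsmul_eq_mul]
  rw [Finset.mul_sum]

omit [Fintype n] [DecidableEq n] [Nonempty n] in
/-- `Σ_c f(c₊) = d·Σ_y f(y)`: each site is the final point of exactly `d` positively oriented bonds (translation by `e_μ` is a bijection of the torus,
✓ `B10StarCount.shiftEquiv`). [cite: Balaban1985Averaging, (5) p.18] -/
theorem sum_pbond_tgt (f : Site P k → ℝ) : ∑ c : PBond P k, f c.tgt = P.d * ∑ y : Site P k, f y := by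
  rw [sum_pbond (fun c : PBond P k => f c.tgt)]
  have h1 : ∀ x : Site P k, ∑ μ : Fin P.d, f (PBond.tgt ⟨x, μ⟩) = ∑ μ : Fin P.d, f (x.shift μ) := fun x => rfl
  simp only [h1]
  rw [Finset.sum_comm]
  have h2 : ∀ μ : Fin P.d, ∑ x : Site P k, f (x.shift μ) = ∑ y : Site P k, f y :=
    fun μ => Fintype.sum_equiv (shiftEquiv μ) _ _ (fun _ => rfl)
  simp only [h2, Finset.sum_const, Finset.card_univ, Fintype.card_fin, nsmul_eq_mul]

/-- ★★ **LEMMA (Ξ), SUMMED OVER THE TORUS.**  For `SU(N)` fields `V`, `h` with `‖h(y) − 1‖ ≤ σ ≤ 1∕20` everywhere and `μ := log ∘ h`: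
`Σ_c‖log(Y_c(V, V^h) + 1) − (μ(c₋) − V_cμ(c₊)V_c*)‖ ≤ 2d·Σ_y‖μ(y)‖²` (`2ab ≤ a² + b²` per bond, then §3's two counts) — the namer's «top cost `= O(Σ_y‖ν(y)‖²)`»
with the constant `2d`. [cite: Balaban1985Averaging, (31) p.22, (8) p.19, (5) p.18] -/
theorem sum_norm_mlog_pertVar_gaugeAct_sub_pureGauge_le (V : GaugeField P k (Matrix.specialUnitaryGroup n ℂ))
    (h : GaugeTransf P k (Matrix.specialUnitaryGroup n ℂ)) {σ : ℝ} (hσ : σ ≤ 1 / 20)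
    (hh : ∀ y : Site P k, ‖((h y : Matrix.specialUnitaryGroup n ℂ) : Matrix n n ℂ) - 1‖ ≤ σ) :
    ∑ c : PBond P k, ‖mlog (pertVar V (GaugeField.gaugeAct h V) c + 1)
        - (mlog ((h c.src : Matrix.specialUnitaryGroup n ℂ) : Matrix n n ℂ)
            - ((V c : Matrix.specialUnitaryGroup n ℂ) : Matrix n n ℂ) * mlog ((h c.tgt : Matrix.specialUnitaryGroup n ℂ) : Matrix n n ℂ)
              * star ((V c : Matrix.specialUnitaryGroup n ℂ) : Matrix n n ℂ))‖
      ≤ 2 * P.d * ∑ y : Site P k, ‖mlog ((h y : Matrix.specialUnitaryGroup n ℂ) : Matrix n n ℂ)‖ ^ 2 := by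
  have hb : ∀ c : PBond P k, ‖mlog (pertVar V (GaugeField.gaugeAct h V) c + 1)
        - (mlog ((h c.src : Matrix.specialUnitaryGroup n ℂ) : Matrix n n ℂ)
            - ((V c : Matrix.specialUnitaryGroup n ℂ) : Matrix n n ℂ) * mlog ((h c.tgt : Matrix.specialUnitaryGroup n ℂ) : Matrix n n ℂ)
              * star ((V c : Matrix.specialUnitaryGroup n ℂ) : Matrix n n ℂ))‖
      ≤ ‖mlog ((h c.src : Matrix.specialUnitaryGroup n ℂ) : Matrix n n ℂ)‖ ^ 2 + ‖mlog ((h c.tgt : Matrix.specialUnitaryGroup n ℂ) : Matrix n n ℂ)‖ ^ 2 := fun c =>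
    (norm_mlog_pertVar_gaugeAct_sub_pureGauge_le V h hσ c (hh _) (hh _)).trans (two_mul_le_add_sq _ _)
  refine (Finset.sum_le_sum fun c _ => hb c).trans (le_of_eq ?_)
  rw [Finset.sum_add_distrib, sum_pbond_src (fun y => ‖mlog ((h y : Matrix.specialUnitaryGroup n ℂ) : Matrix n n ℂ)‖ ^ 2),
    sum_pbond_tgt (fun y => ‖mlog ((h y : Matrix.specialUnitaryGroup n ℂ) : Matrix n n ℂ)‖ ^ 2)]
  ring

/-- The letter form of the summed LEMMA (Ξ): `Σ_c‖…‖ ≤ 8σ²·(d·|T^{(k)}|)` (`8σ²` per bond, `|bonds| = d·|sites|`, ✓ `B10StarCount.card_pbond`).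
[cite: Balaban1985Averaging, (31) p.22, (5) p.18] -/
theorem sum_norm_mlog_pertVar_gaugeAct_sub_pureGauge_le_sq (V : GaugeField P k (Matrix.specialUnitaryGroup n ℂ))
    (h : GaugeTransf P k (Matrix.specialUnitaryGroup n ℂ)) {σ : ℝ} (hσ : σ ≤ 1 / 20)
    (hh : ∀ y : Site P k, ‖((h y : Matrix.specialUnitaryGroup n ℂ) : Matrix n n ℂ) - 1‖ ≤ σ) :
    ∑ c : PBond P k, ‖mlog (pertVar V (GaugeField.gaugeAct h V) c + 1)
        - (mlog ((h c.src : Matrix.specialUnitaryGroup n ℂ) : Matrix n n ℂ)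
            - ((V c : Matrix.specialUnitaryGroup n ℂ) : Matrix n n ℂ) * mlog ((h c.tgt : Matrix.specialUnitaryGroup n ℂ) : Matrix n n ℂ)
              * star ((V c : Matrix.specialUnitaryGroup n ℂ) : Matrix n n ℂ))‖
      ≤ 8 * σ ^ 2 * (P.d * Fintype.card (Site P k)) := by
  refine (Finset.sum_le_sum fun c _ => norm_mlog_pertVar_gaugeAct_sub_pureGauge_le_sq V h hσ c (hh _) (hh _)).trans (le_of_eq ?_)
  rw [Finset.sum_const, Finset.card_univ, B10StarCount.card_pbond, nsmul_eq_mul]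
  push_cast
  ring

end Count

/-! ## §4 The splice: from a row with the twisted top term displayed to the door's `∃ μ` row -/

section Splice

variable {P : Params} {k : ℕ}

/-- ★ **THE GAUGED ROW OF A TWISTED DATUM.**  Let `V`, `h` be as in §3 (`‖h(y) − 1‖ ≤ σ ≤ 1∕20`), `Q` any bond function (e.g. `Q^{(k)}(iD)`) and `Λ` any site function (e.g. the coarse
gauge function of record).  From a row with the TWISTED TOP TERM DISPLAYED, `Σ_c‖Q(c) + (Λ(c₋) − V_cΛ(c₊)V_c*) − log(Y_c(V, V^h) + 1)‖ ≤ R` (the shape of the fibre reading of the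
log-ratio tower without the fibre hypothesis), the door's row holds with the EXPLICIT gauge field `μ := log ∘ h − Λ`:
`Σ_c‖Q(c) − (μ(c₋) − V_cμ(c₊)V_c*)‖ ≤ R + 2d·Σ_y‖log h(y)‖²`. [cite: Balaban1985Averaging, (31) p.22, (11) p.19; Balaban1985Variational, (47)-(48) pp.285-286] -/
theorem gaugedRow_of_twistedRow (V : GaugeField P k (Matrix.specialUnitaryGroup n ℂ)) (h : GaugeTransf P k (Matrix.specialUnitaryGroup n ℂ)) {σ R : ℝ}
    (hσ : σ ≤ 1 / 20) (hh : ∀ y : Site P k, ‖((h y : Matrix.specialUnitaryGroup n ℂ) : Matrix n n ℂ) - 1‖ ≤ σ)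
    (Q : PBond P k → Matrix n n ℂ) (Λ : Site P k → Matrix n n ℂ)
    (hrow : ∑ c : PBond P k, ‖Q c + (Λ c.src - ((V c : Matrix.specialUnitaryGroup n ℂ) : Matrix n n ℂ) * Λ c.tgt * star ((V c : Matrix.specialUnitaryGroup n ℂ) : Matrix n n ℂ))
        - mlog (pertVar V (GaugeField.gaugeAct h V) c + 1)‖ ≤ R) :
    ∑ c : PBond P k, ‖Q c
        - ((mlog ((h c.src : Matrix.specialUnitaryGroup n ℂ) : Matrix n n ℂ) - Λ c.src)
            - ((V c : Matrix.specialUnitaryGroup n ℂ) : Matrix n n ℂ) * (mlog ((h c.tgt : Matrix.specialUnitaryGroup n ℂ) : Matrix n n ℂ) - Λ c.tgt)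
              * star ((V c : Matrix.specialUnitaryGroup n ℂ) : Matrix n n ℂ))‖
      ≤ R + 2 * P.d * ∑ y : Site P k, ‖mlog ((h y : Matrix.specialUnitaryGroup n ℂ) : Matrix n n ℂ)‖ ^ 2 := by
  have hΞ := sum_norm_mlog_pertVar_gaugeAct_sub_pureGauge_le V h hσ hh
  refine le_trans ?_ (add_le_add hrow hΞ)
  rw [← Finset.sum_add_distrib]
  refine Finset.sum_le_sum fun c _ => ?_
  have e : Q c
        - ((mlog ((h c.src : Matrix.specialUnitaryGroup n ℂ) : Matrix n n ℂ) - Λ c.src)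
            - ((V c : Matrix.specialUnitaryGroup n ℂ) : Matrix n n ℂ) * (mlog ((h c.tgt : Matrix.specialUnitaryGroup n ℂ) : Matrix n n ℂ) - Λ c.tgt)
              * star ((V c : Matrix.specialUnitaryGroup n ℂ) : Matrix n n ℂ))
      = (Q c + (Λ c.src - ((V c : Matrix.specialUnitaryGroup n ℂ) : Matrix n n ℂ) * Λ c.tgt * star ((V c : Matrix.specialUnitaryGroup n ℂ) : Matrix n n ℂ))
          - mlog (pertVar V (GaugeField.gaugeAct h V) c + 1))
        + (mlog (pertVar V (GaugeField.gaugeAct h V) c + 1)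
          - (mlog ((h c.src : Matrix.specialUnitaryGroup n ℂ) : Matrix n n ℂ)
            - ((V c : Matrix.specialUnitaryGroup n ℂ) : Matrix n n ℂ) * mlog ((h c.tgt : Matrix.specialUnitaryGroup n ℂ) : Matrix n n ℂ)
              * star ((V c : Matrix.specialUnitaryGroup n ℂ) : Matrix n n ℂ))) := by
    simp only [mul_sub, sub_mul]
    abel
  rw [e]
  exact norm_add_le _ _

/-- The spliced gauge field `μ = log ∘ h − Λ` is `𝔰𝔲(N)`-valued when `Λ` is and `h` is on the (0.4) guard (closure of `𝔰𝔲(N)` under differences, ✓ `Prop7TrueLinReality.su_sub`) — the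
reality row the door ✓ `Prop7LocMinOfGaugedRows` asks of `μ`. [cite: Balaban1985Averaging, (23) p.21; Balaban1987RG1, (0.4) p.253] -/
theorem su_splicedGauge (h : GaugeTransf P k (Matrix.specialUnitaryGroup n ℂ)) (Λ : Site P k → Matrix n n ℂ)
    (hΛ : ∀ y, star (Λ y) = -Λ y ∧ (Λ y).trace = 0) (h1 : ∀ y, ‖((h y : Matrix.specialUnitaryGroup n ℂ) : Matrix n n ℂ) - 1‖ < deltaSU n) (y : Site P k) :
    star (mlog ((h y : Matrix.specialUnitaryGroup n ℂ) : Matrix n n ℂ) - Λ y) = -(mlog ((h y : Matrix.specialUnitaryGroup n ℂ) : Matrix n n ℂ) - Λ y)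
      ∧ (mlog ((h y : Matrix.specialUnitaryGroup n ℂ) : Matrix n n ℂ) - Λ y).trace = 0 :=
  su_sub (su_mlog_transf h y (h1 y)) (hΛ y)

end Splice

end Summit.QuantumFields.YangMills.Theorems.Prop7GaugeTwistLogRatio

end
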